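import Summits.AnomalousDissipation.AnomalousDissipation.Theses.TwoAndHalfD

/-!
# Sketch (crux-ideate, round 1, ideator 3) — first lemmas for crux
`ScalarAnomalySteadySourceFormal` (stmt-AnomalousDissipation-0448, route TwoAndHalfD)

Two idea cards, one lever each:

* Card `a-posteriori-orbit-transfer` — the crux is closed under `o(ν_j)`-shadowing of a DESIGNER
  velocity path by an EXACT Leray–Hopf orbit of the fixed force: `ScalarShadowDissipation`,
  `ScalarShadowTransfer` (provable now), `NearOrbitWitness` (= C⁺), `NearOrbitTransfer` (C⁺ → crux).
* Card `selective-mixing-torque-skeleton` — at `Pr = 1` the vorticity is the sourced scalar with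
  source `curl g`; a flow that relaxes its own torque profile has bounded enstrophy, hence (DiPerna–
  Lions) no scalar anomaly: `planarCurl`, `TorqueRelaxationBoundsEnstrophy` (provable now),
  `NoWitnessRelaxesItsTorque` (paper proof = SINGLE_SHELL_2HALFD renormalisation chain).

Nothing here is asserted; every `def … : Prop` is a target. Checked with `lean check` (rc 0 expected).
-/

noncomputable section

open MeasureTheory Set Filter Topology
open scoped InnerProductSpace ENNReal NNReal

namespace Summit.AnomalousDissipation.AnomalousDissipation.Cruxes.ScalarAnomalySteadySourceFormal.SketchIdeator3

open Literature.Analysis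

local notation "𝕋²" => UnitAddTorus (Fin 2)
local notation "ℝ²" => EuclideanSpace ℝ (Fin 2)

/-! ## Card A — a-posteriori orbit transfer (shadowing / Newton–Kantorovich near a design) -/

/-- **ScalarShadowDissipation** (first lemma of card A; provable now, M).
Two classical solutions `θ`, `Θ` of the SAME steadily sourced advection–diffusion equation
(`κ > 0`, source `h`) driven by two smooth divergence-free velocity paths `v`, `V` that stay
`δ`-close in `L^∞_{t,x}` on `t ≥ 0`, with equal initial means and `L²`-bounds `B`, have a
difference `D = θ - Θ` whose long-time-mean dissipation is small:
`⟨κ‖∇D‖²⟩ ≤ δ² B / κ` (energy identity for `D`: `∂ₜD + v·∇D - κΔD = -(v-V)·∇Θ`, test with `D`,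
move the derivative onto `D` using `div (v-V) = 0`, Young). -/
def ScalarShadowDissipation : Prop :=
  ∀ (κ δ B : ℝ), 0 < κ → 0 ≤ δ → 0 ≤ B →
  ∀ (h : 𝕋² → ℝ) (v V : ℝ → 𝕋² → ℝ²) (θ Θ : ℝ → 𝕋² → ℝ),
    FluidPDE.Torus.IsClassicalScalarTransportForcedOn (Ici 0) κ v (fun _ => h) θ →
    FluidPDE.Torus.IsClassicalScalarTransportForcedOn (Ici 0) κ V (fun _ => h) Θ →
    (∀ t, 0 ≤ t → ∀ x, ‖v t x - V t x‖ ≤ δ) →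
    (∫ x, θ 0 x) = (∫ x, Θ 0 x) →
    (∀ t, 0 ≤ t → FluidPDE.Torus.scalarL2Sq (θ t) ≤ B) →
    (∀ t, 0 ≤ t → FluidPDE.Torus.scalarL2Sq (Θ t) ≤ B) →
    FluidPDE.longTimeAvgSup (fun t => κ * FluidPDE.Torus.scalarGradNormSq (fun x => θ t x - Θ t x))
      ≤ δ ^ 2 * B / κ

/-- **ScalarShadowTransfer** (card A; provable now from `ScalarShadowDissipation`, the triangle
inequality in the `⟨·⟩^{1/2}`-seminorm and Poincaré `‖D‖² ≤ ‖∇D‖²/(4π²)` for the mean-zero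
difference): the FLUX FLOOR of the design degrades by at most `2√ε · δ√(B/κ)` and the VARIANCE
CEILING by at most `2δ²B/(4π²κ²)`. Tolerances: `δ = o(√(κ ε / B))` for the flux, `δ = o(κ)` for
the variance — polynomial in `κ = ν_j`. -/
def ScalarShadowTransfer : Prop :=
  ∀ (κ δ B ε E : ℝ), 0 < κ → 0 ≤ δ → 0 ≤ B → 0 ≤ ε →
  ∀ (h : 𝕋² → ℝ) (v V : ℝ → 𝕋² → ℝ²) (θ Θ : ℝ → 𝕋² → ℝ),
    FluidPDE.Torus.IsClassicalScalarTransportForcedOn (Ici 0) κ v (fun _ => h) θ →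
    FluidPDE.Torus.IsClassicalScalarTransportForcedOn (Ici 0) κ V (fun _ => h) Θ →
    (∀ t, 0 ≤ t → ∀ x, ‖v t x - V t x‖ ≤ δ) →
    (∫ x, θ 0 x) = (∫ x, Θ 0 x) →
    (∀ t, 0 ≤ t → FluidPDE.Torus.scalarL2Sq (θ t) ≤ B) →
    (∀ t, 0 ≤ t → FluidPDE.Torus.scalarL2Sq (Θ t) ≤ B) →
    ε ≤ FluidPDE.longTimeAvgSup (fun t => κ * FluidPDE.Torus.scalarGradNormSq (Θ t)) →
    FluidPDE.longTimeAvgSup (fun t => FluidPDE.Torus.scalarL2Sq (Θ t)) ≤ E →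
    ε - 2 * Real.sqrt ε * δ * Real.sqrt (B / κ)
        ≤ FluidPDE.longTimeAvgSup (fun t => κ * FluidPDE.Torus.scalarGradNormSq (θ t)) ∧
      FluidPDE.longTimeAvgSup (fun t => FluidPDE.Torus.scalarL2Sq (θ t))
        ≤ 2 * E + 2 * (δ ^ 2 * B) / (4 * Real.pi ^ 2 * κ ^ 2)

/-- **NearOrbitWitness** — the transferred form C⁺ of the crux (card A). Everything quantitative is
evaluated on a DESIGNER path `V j` (any smooth divergence-free velocity path: an inverse-design /
asymptotic / certified-numerical construction) and its sourced scalar `Θ j`; the Navier–Stokes side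
only has to deliver an EXACT global Leray–Hopf orbit `v j` of the FIXED steady force `g` staying
within `c · ν j` of `V j` in `L^∞_{t,x}` for all `t ≥ 0` (a posteriori: Newton–Kantorovich for a
periodic design, shadowing for an aperiodic hyperbolic one), and its scalar `θ j` (classical = weak
for smooth data). -/
def NearOrbitWitness : Prop :=
  ∃ (g : 𝕋² → ℝ²) (h : 𝕋² → ℝ), FunctionSpaces.Torus.IsSmooth g ∧ FunctionSpaces.Torus.IsDivFree g ∧
    FunctionSpaces.Torus.HasZeroMean g ∧ FunctionSpaces.Torus.IsSmooth h ∧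
    FunctionSpaces.Torus.HasZeroMean h ∧
  ∃ (ν : ℕ → ℝ) (v₀ : ℕ → 𝕋² → ℝ²) (v V : ℕ → ℝ → 𝕋² → ℝ²) (θ₀ : ℕ → 𝕋² → ℝ)
    (θ Θ : ℕ → ℝ → 𝕋² → ℝ) (B E ε c : ℝ),
    0 < ε ∧ 0 ≤ B ∧ 0 ≤ c ∧ (∀ j, 0 < ν j) ∧ Tendsto ν atTop (𝓝 0) ∧
    (∀ j, FluidPDE.Torus.IsGlobalLerayHopf (ν j) (fun _ => g) (v₀ j) (v j)) ∧
    (∀ j, MemLp (θ₀ j) 2 volume) ∧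
    (∀ j, FluidPDE.Torus.IsWeakScalarTransportForced (ν j) (v j) (fun _ => h) (θ₀ j) (θ j)) ∧
    (∀ j, FluidPDE.Torus.IsClassicalScalarTransportForcedOn (Ici 0) (ν j) (v j) (fun _ => h) (θ j)) ∧
    (∀ j, FluidPDE.Torus.IsClassicalScalarTransportForcedOn (Ici 0) (ν j) (V j) (fun _ => h) (Θ j)) ∧
    (∀ j, (∫ x, θ j 0 x) = ∫ x, Θ j 0 x) ∧
    (∀ j t, 0 ≤ t → ∀ x, ‖v j t x - V j t x‖ ≤ c * ν j) ∧
    (∀ j t, 0 ≤ t → FluidPDE.Torus.scalarL2Sq (θ j t) ≤ B) ∧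
    (∀ j t, 0 ≤ t → FluidPDE.Torus.scalarL2Sq (Θ j t) ≤ B) ∧
    (∀ j, FluidPDE.meanEnergy (v j) ≤ E) ∧
    (∀ j, FluidPDE.longTimeAvgSup (fun t => FluidPDE.Torus.scalarL2Sq (Θ j t)) ≤ E) ∧
    (∀ j, 4 * ε ≤ FluidPDE.longTimeAvgSup (fun t => ν j * FluidPDE.Torus.scalarGradNormSq (Θ j t)))

/-- **NearOrbitTransfer** (card A composition target): `NearOrbitWitness → crux`. Proof plan:
`ScalarShadowTransfer` with `δ = c ν_j` gives flux `≥ 4ε - 4c√(εBν_j) ≥ ε` and variance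
`≤ 2E + c²B/(2π²)` for all large `j`; `scalarGradNormSq = (eScalarGradNormSq ·).toReal` for the
smooth `θ j t` (`FluidPDE.Torus.scalarGradNormSq_eq_toReal`); reindex the sequence past the
finitely many bad `j`. -/
def NearOrbitTransfer : Prop :=
  NearOrbitWitness → Theses.TwoAndHalfD.ScalarAnomalySteadySourceFormal

/-! ## Card B — selective mixing: the witness must NOT relax its own torque profile -/

/-- The planar curl `∂₁w₂ - ∂₂w₁` of a vector field on `𝕋²` (the vorticity of a velocity, the
torque `curl g` of a force), via the accepted `FunctionSpaces.Torus.partialDeriv`. -/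
def planarCurl (w : 𝕋² → ℝ²) : 𝕋² → ℝ :=
  fun x => (FunctionSpaces.Torus.partialDeriv (0 : Fin 2) w x) 1
    - (FunctionSpaces.Torus.partialDeriv (1 : Fin 2) w x) 0

/-- **TorqueRelaxationBoundsEnstrophy** (first lemma of card B; provable now, M). At `Pr = 1` the
vorticity `ω = planarCurl (v t)` of a classical 2-D Navier–Stokes solution with steady force `g`
solves the SAME sourced advection–diffusion equation as the crux's scalar, with source
`γ = planarCurl g`. Hence, by Duhamel and uniqueness of classical solutions of the linear problem,
if the flow relaxes the released torque profile from every phase `s ≥ 0` at a uniform exponential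
rate — `‖ζ_s(t)‖₂ ≤ C e^{-rt}‖γ‖₂` for the unsourced solution `ζ_s` from phase `s` with datum `γ` —
then `‖ω(t)‖₂ ≤ ‖ω(0)‖₂ + C‖γ‖₂/r` for all `t ≥ 0`; on `𝕋²`, `‖ω‖₂² = ‖∇v‖₂² = gradNormSq v`. -/
def TorqueRelaxationBoundsEnstrophy : Prop :=
  ∀ (ν C r : ℝ), 0 < ν → 0 ≤ C → 0 < r →
  ∀ (g : 𝕋² → ℝ²) (v : ℝ → 𝕋² → ℝ²) (p : ℝ → 𝕋² → ℝ),
    FunctionSpaces.Torus.IsSmooth g → FunctionSpaces.Torus.IsDivFree g →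
    FunctionSpaces.Torus.HasZeroMean g →
    FunctionSpaces.Torus.IsClassicalNSSolutionOn (Ici 0) ν (fun _ => g) v p →
    (∀ s, 0 ≤ s → ∃ ζ : ℝ → 𝕋² → ℝ,
        FluidPDE.Torus.IsClassicalScalarTransportOn (Ici 0) ν (fun t => v (s + t)) ζ ∧
        ζ 0 = planarCurl g ∧
        ∀ t, 0 ≤ t → FluidPDE.Torus.scalarL2Sq (ζ t)
          ≤ C ^ 2 * Real.exp (-2 * r * t) * FluidPDE.Torus.scalarL2Sq (planarCurl g)) →
    ∀ t, 0 ≤ t →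
      Real.sqrt (FunctionSpaces.Torus.gradNormSq (v t))
        ≤ Real.sqrt (FunctionSpaces.Torus.gradNormSq (v 0))
          + C * Real.sqrt (FluidPDE.Torus.scalarL2Sq (planarCurl g)) / r

/-- **NoWitnessRelaxesItsTorque** (card B necessity target; paper proof: `TorqueRelaxationBounds
Enstrophy` ⇒ `sup_j sup_t ‖∇v_j(t)‖₂ < ∞` ⇒ compactness + DiPerna–Lions renormalisation of the
limit transport equation ⇒ `⟨(h, θ_j)⟩ = ν_j⟨‖∇θ_j‖²⟩ → 0`, the SINGLE_SHELL_2HALFD.md chain on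
0448; L-sized in Lean). A family of classical bounded-energy 2-D Navier–Stokes flows with the fixed
force `g` that relaxes the torque profile `planarCurl g` ν-UNIFORMLY (same `C, r` for all `j` and
all phases) carries no steady-source scalar anomaly, whatever the smooth source `h`: universal
(profile-blind) mixers — in particular anything satisfying route LimitingAbsorption's `(U_h)` for
the profile `curl g` as well as for `h` — cannot witness the crux. -/
def NoWitnessRelaxesItsTorque : Prop :=
  ∀ (g : 𝕋² → ℝ²) (h : 𝕋² → ℝ), FunctionSpaces.Torus.IsSmooth g → FunctionSpaces.Torus.IsDivFree g →
    FunctionSpaces.Torus.HasZeroMean g → FunctionSpaces.Torus.IsSmooth h →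
    FunctionSpaces.Torus.HasZeroMean h →
  ∀ (ν : ℕ → ℝ) (v : ℕ → ℝ → 𝕋² → ℝ²) (p : ℕ → ℝ → 𝕋² → ℝ) (θ : ℕ → ℝ → 𝕋² → ℝ) (C r Z₀ B E : ℝ),
    (∀ j, 0 < ν j) → Tendsto ν atTop (𝓝 0) → 0 ≤ C → 0 < r →
    (∀ j, FunctionSpaces.Torus.IsClassicalNSSolutionOn (Ici 0) (ν j) (fun _ => g) (v j) (p j)) →
    (∀ j, FunctionSpaces.Torus.gradNormSq (v j 0) ≤ Z₀) →
    (∀ j, FluidPDE.meanEnergy (v j) ≤ E) →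
    (∀ j, FluidPDE.Torus.IsClassicalScalarTransportForcedOn (Ici 0) (ν j) (v j) (fun _ => h) (θ j)) →
    (∀ j t, 0 ≤ t → FluidPDE.Torus.scalarL2Sq (θ j t) ≤ B) →
    (∀ j s, 0 ≤ s → ∃ ζ : ℝ → 𝕋² → ℝ,
        FluidPDE.Torus.IsClassicalScalarTransportOn (Ici 0) (ν j) (fun t => v j (s + t)) ζ ∧
        ζ 0 = planarCurl g ∧
        ∀ t, 0 ≤ t → FluidPDE.Torus.scalarL2Sq (ζ t)
          ≤ C ^ 2 * Real.exp (-2 * r * t) * FluidPDE.Torus.scalarL2Sq (planarCurl g)) →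
    Tendsto (fun j => FluidPDE.longTimeAvgSup
        (fun t => ν j * FluidPDE.Torus.scalarGradNormSq (θ j t))) atTop (𝓝 0)

end Summit.AnomalousDissipation.AnomalousDissipation.Cruxes.ScalarAnomalySteadySourceFormal.SketchIdeator3

end
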